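import Summits.CriticalPhenomena.PercolationContinuityZ3.Theorems.PercNearOneGluingNoHeavyLowerTailFKHullPortDeltaNTools
import Summits.CriticalPhenomena.PercolationContinuityZ3.Theorems.PercNearOneGluingNoHeavyLowerTailFKAvoidedClusterEdge
import Literature.Probability.Percolation.KozmaNitzanPreFKG
import HarnessLib

/-!
# FK sub-lane: Lemma 2 (coefficient monotonicity) of the hull-port argument for `φ_{𝐩,q}`, avoided-set form

Support file (`--supports stmt-CriticalPhenomena-4575`), FK sub-lane `prim-bschramm-fk-2` (gen 3); builds on p205010 (kernel theorem,
internal audit signed; external expert review pending).  No definitions, no named facts, no sorries; standard axioms.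

prim-hp-7's Lemma 2 (`a₀ b₁ ≥ a₁ b₀` in (★) of HP7-MDLX-PROOF §3) for the random-cluster measure, for an avoided vertex SET `X` and in
the sum-level vocabulary of `…FKHullPortTADefs.lean` (bschramm/FK-Q2.md §12.6(a)):
* `FK.lemma2_measure_rc` — for `e = s(a,b)` with `a ∈ T`: `φ(D∩{y↔z}∩{e open})·φ(D∩{e closed}) ≤ φ(D∩{y↔z}∩{e closed})·φ(D∩{e open})`,
  `D = {y ↮ T}` — i.e. `Cov_{φ(·|D)}(1{y↔z}, ω_e) ≤ 0`; ONE LINE from gen-2's `FK.avoidedCluster_negCorrelation_openPair_rc` (vdBHK Thm 2.1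
  for `φ_{𝐩,q}` with `S = {y}`, `T`), for exits AND internal pairs alike (only `a ∈ T` is used);
* `FK.taa_tab_mono` — the sum form `a(w[e↦1], X∪{b})·b(w[e↦0], X) ≤ a(w[e↦0], X)·b(w[e↦1], X∪{b})` (contraction lowers the coefficient
  `r = φ(y↔z | y ↮ s, X)`): the cross-factor `hL` of the `T_A` Bernstein step (`…FKHullPortTAInduction.lean`).
[cite: VandenbergHaggstromKahn2005, Thm. 2.1 (p. 9), Thm. 1.3 (p. 6); §2.1 Lemma 2.3 (p. 10)] [cite: Gladkov2024, Thm. 3.2 (p. 4)]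
[cite: Grimmett2006, §1.4 eq. (1.20) (p. 15); Thm. (3.1)(a) (p. 37); Thm. (3.8)(b)]
-/

noncomputable section

namespace Summit.CriticalPhenomena.PercolationContinuityZ3.Theorems.FK

open MeasureTheory Set Literature.Probability.LatticeModels Literature.Probability.Percolation
open Literature.Probability.Percolation.DecisionTree (ind ind_of_mem ind_of_not_mem ind_nonneg)
open Literature.Probability.Percolation.BHK2006 (rcMass delW)
open Summit.CriticalPhenomena.PercolationContinuityZ3.Theorems.HullPort (cut avoidEv)
open scoped Classical

variable {V : Type*} [Fintype V]

section Lemma2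

open Literature.Probability.Percolation.BHK2006 (weight rcMass_nonneg coe_delW)
open Literature.Probability.Percolation.KNPreFKG
open Summit.CriticalPhenomena.PercolationContinuityZ3.Theorems.HullPort (insert_mem_avoidEv_iff cut_insert_edge edge_mem_cut
  eq_of_reachable_of_isolated mem_cut_of_mem not_mem_of_reachable_of_noBoundary cut_eq_of_noBoundary
  bernstein_step bernstein_step_degenerate)

/-- **Lemma 2 of the hull-port argument for `φ_{𝐩,q}` (measure form, avoided SET)**: for a pair `e = s(a,b)` with `a ∈ {s} ∪ X`,
`D = {y ↮ {s} ∪ X}`: `φ(D ∩ {y↔z} ∩ {e open})·φ(D ∩ {e closed}) ≤ φ(D ∩ {y↔z} ∩ {e closed})·φ(D ∩ {e open})` — given avoidance, the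
connection `{y ↔ z}` of the avoiding cluster is negatively correlated with an open pair at the avoided set.  One line from
`FK.avoidedCluster_negCorrelation_openPair_rc` (van den Berg–Häggström–Kahn Thm 2.1 for `φ_{𝐩,q}`).
[cite: VandenbergHaggstromKahn2005, Thm. 2.1 (p. 9), Thm. 1.3 (p. 6)] -/
theorem lemma2_measure_rc (w : Sym2 V → unitInterval) {q : ℝ} (hq : 1 ≤ q) (T : Set V) {y z a b : V} (haT : a ∈ T)
    (hab : a ≠ b) :
    (rcMeasureW w q ∅).real ({ω : BondConfig V | ∀ t ∈ T, ¬ (openGraph ω).Reachable y t} ∩ openConn y z ∩ {ω | s(a, b) ∈ ω}) *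
        (rcMeasureW w q ∅).real ({ω : BondConfig V | ∀ t ∈ T, ¬ (openGraph ω).Reachable y t} ∩ {ω | s(a, b) ∈ ω}ᶜ) ≤
      (rcMeasureW w q ∅).real ({ω : BondConfig V | ∀ t ∈ T, ¬ (openGraph ω).Reachable y t} ∩ openConn y z ∩ {ω | s(a, b) ∈ ω}ᶜ) *
        (rcMeasureW w q ∅).real ({ω : BondConfig V | ∀ t ∈ T, ¬ (openGraph ω).Reachable y t} ∩ {ω | s(a, b) ∈ ω}) := by
  classical
  have hq0 : 0 < q := one_pos.trans_le hq
  haveI := isProbabilityMeasure_rcMeasureW w hq0 (∅ : Set V)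
  set φ := rcMeasureW w q ∅ with hφ
  set D : Set (BondConfig V) := {ω | ∀ t ∈ T, ¬ (openGraph ω).Reachable y t} with hD
  set O : Set (BondConfig V) := {ω | s(a, b) ∈ ω} with hO
  set Zev : Set (BondConfig V) := openConn y z with hZev
  have hmeas : ∀ S : Set (BondConfig V), MeasurableSet S := fun _ => MeasurableSet.of_discrete
  have key := avoidedCluster_negCorrelation_openPair_rc w hq y T haT hab ((connFamily y z).indicator 1)
    (monotone_indicator_one_of_isUpperSet (isUpperSet_connFamily y z))
  have hFz : ∀ ω : BondConfig V, (connFamily y z).indicator (1 : Set (Sym2 V) → ℝ) (openEdgeCluster ω y) =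
      Zev.indicator (1 : BondConfig V → ℝ) ω := fun ω => by
    rw [congrFun (indicator_comp_openEdgeCluster (connFamily y z) y) ω, ← openConn_eq_setOf_connFamily]
  simp only [hFz] at key
  rw [setIntegral_indicator_one_eq, setIntegral_indicator_one_eq] at key
  -- key : φ(D) * φ((D ∩ O) ∩ Zev) ≤ φ(D ∩ Zev) * φ(D ∩ O)
  have hDsplit : φ.real D = φ.real (D ∩ O) + φ.real (D ∩ Oᶜ) := by
    rw [← measureReal_inter_add_sdiff (μ := φ) (s := D) (h := measure_ne_top _ _) (hmeas O), Set.sdiff_eq]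
  have hDZsplit : φ.real (D ∩ Zev) = φ.real (D ∩ Zev ∩ O) + φ.real (D ∩ Zev ∩ Oᶜ) := by
    rw [← measureReal_inter_add_sdiff (μ := φ) (s := D ∩ Zev) (h := measure_ne_top _ _) (hmeas O), Set.sdiff_eq]
  have hA : (D ∩ O) ∩ Zev = D ∩ Zev ∩ O := by ac_rfl
  rw [hA, hDsplit, hDZsplit] at key
  have hn := fun (S : Set (BondConfig V)) => (measureReal_nonneg : 0 ≤ φ.real S)
  nlinarith [key, hn (D ∩ O), hn (D ∩ Zev ∩ O)]

/-- **Lemma 2 in sum form** (`a₀ b₁ ≥ a₁ b₀` of prim-hp-7's (★) for `φ_{𝐩,q}`): for a fractional pair `e = s(a,b)` touching `X`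
(`a ∈ X`), `a(w[e↦1], X∪{b})·b(w[e↦0], X) ≤ a(w[e↦0], X)·b(w[e↦1], X∪{b})` — the random-cluster coefficient
`r = φ(y ↔ z | y ↮ s, X)` is smaller after contraction than after deletion (set form of `FK.coefficient_mono_rc`).
[cite: VandenbergHaggstromKahn2005, Thm. 2.1 (p. 9)] [cite: Grimmett2006, Thm. (3.1)(a)] -/
theorem taa_tab_mono (w : Sym2 V → unitInterval) {q : ℝ} (hq : 1 ≤ q) (s y z : V) (X : Set V) {a b : V} (ha : a ∈ X)
    (hab : a ≠ b) (h0 : 0 < ((w s(a, b) : unitInterval) : ℝ)) (h1 : ((w s(a, b) : unitInterval) : ℝ) < 1) :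
    taa (Function.update w s(a, b) 1) q s y z (insert b X) * tab (Function.update w s(a, b) 0) q s y X ≤
      taa (Function.update w s(a, b) 0) q s y z X * tab (Function.update w s(a, b) 1) q s y (insert b X) := by
  classical
  have hq0 : 0 < q := one_pos.trans_le hq
  set e : Sym2 V := s(a, b) with he
  set w₀ := Function.update w e 0 with hw₀
  set w₁ := Function.update w e 1 with hw₁
  have h1e : ((w₁ e : unitInterval) : ℝ) = 1 := by simp [hw₁]
  have h0e : ((w₀ e : unitInterval) : ℝ) = 0 := by simp [hw₀]
  rw [taa_absorb w₁ q s y z a b X ha h1e, tab_absorb w₁ q s y a b X ha h1e]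
  set D : Set (BondConfig V) := avoidEv y (insert s X) with hD
  set O : Set (BondConfig V) := {ω | e ∈ ω} with hO
  set Zev : Set (BondConfig V) := openConn y z with hZev
  set t : ℝ := ((w e : unitInterval) : ℝ) with ht
  -- the four masses as multiples of the corner quantities
  have hS : ∀ (A : Set (BondConfig V)), (rcMeasureW w q ∅).real A * rcPartitionFunctionW w q ∅ =
      ∑ ω, rcWeightW w q ∅ ω * ind A ω := by
    intro A
    rw [rcMeasureW_real_eq_sum_div w hq0 ∅ A, div_mul_cancel₀ _ (rcPartitionFunctionW_pos w hq0 ∅).ne']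
  have z1 : ∀ ω, e ∉ ω → rcWeightW w₁ q ∅ ω = 0 := fun ω hω => rcWeightW_eq_zero_of_one_not_mem w₁ q ∅ h1e hω
  have z0 : ∀ ω, e ∈ ω → rcWeightW w₀ q ∅ ω = 0 := fun ω hω => rcWeightW_eq_zero_of_zero_mem w₀ q ∅ h0e hω
  have mO : ∀ (A : Set (BondConfig V)), ∑ ω, rcWeightW w q ∅ ω * ind (A ∩ O) ω = t * ∑ ω, rcWeightW w₁ q ∅ ω * ind A ω := by
    intro A
    rw [Finset.mul_sum]
    refine Finset.sum_congr rfl fun ω _ => ?_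
    rw [rcWeightW_split w q ∅ e ω]
    by_cases heω : e ∈ ω
    · rw [if_pos heω]
      have : ind (A ∩ O) ω = ind A ω := by
        by_cases hA : ω ∈ A
        · rw [ind_of_mem hA, ind_of_mem (Set.mem_inter hA heω)]
        · rw [ind_of_not_mem hA, ind_of_not_mem (fun h => hA h.1)]
      rw [this]; ring
    · rw [if_neg heω, ind_of_not_mem (fun h : ω ∈ A ∩ O => heω h.2), z1 ω heω]; ring
  have mOc : ∀ (A : Set (BondConfig V)), ∑ ω, rcWeightW w q ∅ ω * ind (A ∩ Oᶜ) ω = (1 - t) * ∑ ω, rcWeightW w₀ q ∅ ω * ind A ω := by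
    intro A
    rw [Finset.mul_sum]
    refine Finset.sum_congr rfl fun ω _ => ?_
    rw [rcWeightW_split w q ∅ e ω]
    by_cases heω : e ∈ ω
    · rw [if_pos heω, ind_of_not_mem (fun h : ω ∈ A ∩ Oᶜ => h.2 heω), z0 ω heω]; ring
    · rw [if_neg heω]
      have : ind (A ∩ Oᶜ) ω = ind A ω := by
        by_cases hA : ω ∈ A
        · rw [ind_of_mem hA, ind_of_mem (Set.mem_inter hA heω)]
        · rw [ind_of_not_mem hA, ind_of_not_mem (fun h => hA h.1)]
      rw [this]; ring
  -- the measure-level inequality, multiplied out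
  have hL := lemma2_measure_rc w hq (insert s X) (y := y) (z := z) (Set.mem_insert_of_mem _ ha) hab
  have hDset : {ω : BondConfig V | ∀ t ∈ insert s X, ¬ (openGraph ω).Reachable y t} = D := rfl
  rw [hDset, ← he] at hL
  have hZ := rcPartitionFunctionW_pos w hq0 ∅
  have hL' : (∑ ω, rcWeightW w q ∅ ω * ind (D ∩ Zev ∩ O) ω) * (∑ ω, rcWeightW w q ∅ ω * ind (D ∩ Oᶜ) ω) ≤
      (∑ ω, rcWeightW w q ∅ ω * ind (D ∩ Zev ∩ Oᶜ) ω) * (∑ ω, rcWeightW w q ∅ ω * ind (D ∩ O) ω) := by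
    rw [← hS, ← hS, ← hS, ← hS]
    have := mul_le_mul_of_nonneg_right hL (mul_nonneg hZ.le hZ.le)
    nlinarith [this]
  rw [mO (D ∩ Zev), mOc D, mOc (D ∩ Zev), mO D] at hL'
  -- identify the corner sums with `taa`, `tab`
  have ea : ∀ (u : Sym2 V → unitInterval), ∑ ω, rcWeightW u q ∅ ω * ind (D ∩ Zev) ω = taa u q s y z X := fun u => rfl
  have eb : ∀ (u : Sym2 V → unitInterval), ∑ ω, rcWeightW u q ∅ ω * ind D ω = tab u q s y X := fun u => rfl
  rw [ea, eb, ea, eb] at hL'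
  have ht0 : 0 < t := h0
  have ht1 : t < 1 := h1
  have hpos : 0 < t * (1 - t) := mul_pos ht0 (sub_pos.2 ht1)
  have key : t * (1 - t) * (taa w₁ q s y z X * tab w₀ q s y X) ≤ t * (1 - t) * (taa w₀ q s y z X * tab w₁ q s y X) := by
    nlinarith [hL']
  exact le_of_mul_le_mul_left key hpos

end Lemma2

end Summit.CriticalPhenomena.PercolationContinuityZ3.Theorems.FK

end
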